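import Mathlib.Analysis.Calculus.Rademacher
import Mathlib.Analysis.Calculus.BumpFunction.InnerProduct
import Mathlib.Analysis.InnerProductSpace.Laplacian
import Mathlib.MeasureTheory.Integral.Prod
import Mathlib.MeasureTheory.Function.SpecialFunctions.Inner
import Literature.Analysis.FluidPDE.WholeSpaceIBP
import Literature.Analysis.FluidPDE.DivFreeDriftPositivityPropagation
import HarnessLib

/-!
# Propagation of positivity (Nazarov–Ural'tseva 2011, Cor. 3.2 / Lei–Ren–Tian 2025, Lemma 2.5): the CLASSICAL special case

Topic `Literature/Analysis/FluidPDE` (family `ns`). Companion of `DivFreeDriftPositivityPropagation.lean`, which vendors the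
NAMED FACT `Literature.Analysis.FluidPDE.NazarovUraltseva2011_positivity_propagation E` verbatim as printed: propagation of
positivity for nonnegative LIPSCHITZ generalized supersolutions of `∂ₜV − ΔV + b·∇V = 0` on the cylinder `(0,T) × B(0,1)`,
the drift being jointly measurable, pointwise bounded and divergence free in `𝒟′`, the supersolution property being the
integral inequality `∫∫ (∂ₜV η + ⟪∇V, ∇η⟫ + ⟪b, ∇V⟫ η) ≥ 0` against every nonnegative Lipschitz test function `η` vanishing
near the parabolic boundary (Nazarov–Ural'tseva 2011, p. 2–3 and p. 8 of arXiv:1011.1888).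

This file PROVES the classical special case requested by the route `AxisTwistDoor` of `NavierStokesRegularity` (crux
`AveragedConeLiouville`, cite item wi-87110, skeleton constant `PositivityPropagationFact(C)`): the same conclusion for `V` of
class `C²` and Lipschitz on the open cylinder, nonnegative, satisfying the POINTWISE inequality `∂ₜV − ΔV + ⟪b, ∇V⟫ ≥ 0`
for a drift `b` of class `C¹` on the cylinder with `‖b‖ ≤ Λ` and `div b = 0` pointwise — as a consequence of the named fact
(`NazarovUraltseva2011_positivity_propagation.classical_of_lipschitz`), plus the variant with "`C²` on an open
neighbourhood of the closed cylinder" (`NazarovUraltseva2011_positivity_propagation.classical`). Net debt 0: no new fact.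

## Proof

* the drift is zero-extended off the cylinder (`Set.indicator`): jointly measurable (continuous on the open cylinder),
  bounded there, and divergence free in `𝒟′` — for a smooth `φ` compactly supported inside the cylinder, Fubini in time and
  the whole-space identity `∫ φ div u + ∫ ⟪u, ∇φ⟫ = 0` (`WholeSpaceIBP`) applied to a cut-off extension `u` of `b(t,·)`
  (`NazarovUraltseva2011.setIntegral_inner_drift_gradient_eq_zero`);
* the generalized-supersolution inequality is verified against LIPSCHITZ test functions slice by slice: at a fixed time the
  term `∫ ⟪∇V, ∇η⟫` is integrated by parts in `x` against the Lipschitz `η(t,·)` — Mathlib's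
  `LipschitzWith.integral_lineDeriv_mul_eq` coordinatewise in an orthonormal basis, with Rademacher's theorem
  (`LipschitzWith.ae_differentiableAt`) identifying line derivatives with the gradient a.e.
  (`NazarovUraltseva2011.integral_inner_gradient_eq_neg_integral_laplacian_mul`, the statement that the a.e. gradient of a
  Lipschitz function is its weak gradient, Evans–Gariepy Thm 4.5 / Thm 6.5), after replacing `V(t,·)` by a compactly supported
  cut-off extension that agrees with it near the support of `η(t,·)`; the printed inequality keeps `∂ₜV·η`, so there is NO
  integration by parts in time and no boundary term at `t = T` (`…setIntegral_slice_supersolution_nonneg`,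
  `…setIntegral_cylinder_supersolution_nonneg`; a non-integrable space–time integrand has Bochner integral `0`, so that case
  is trivial);
* "`C²` on a neighbourhood of the closed cylinder" gives the Lipschitz bound on the compact convex closed cylinder
  (`ContDiffOn.exists_lipschitzOnWith`).

## What is NOT here

The named fact itself is NOT proved (De Giorgi–Nash–Moser with divergence-free drift). `C²` on the OPEN cylinder alone does
not specialise the fact (no Lipschitz bound up to the parabolic boundary; the windows `t̄ ∈ (0,T/3)`, `t ∈ (T/2,T)` are rigid),
which is why the Lipschitz binder appears. No instances, no notation.

## References

* A. I. Nazarov, N. N. Ural'tseva, *The Harnack inequality and related properties for the equations with divergence-free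
  lower-order coefficients*, Algebra i Analiz 23:1 (2011) 136–168 = St. Petersburg Math. J. 23 (2012) 93–115, arXiv:1011.1888:
  generalized (sub/super)solutions p. 2–3, p. 8; Cor. 3.2 (p. 10). [cite: NazarovUraltseva2011HarnackDivFree, Cor 3.2 (arXiv p.10)]
* Z. Lei, X. Ren, G. Tian, *A geometric characterization of potential Navier–Stokes singularities*, arXiv:2501.08976 (2025),
  Lemma 2.5 (p. 7). [cite: LeiRenTian2025, Lemma 2.5 (arXiv p.7)]
* L. C. Evans, R. F. Gariepy, *Measure Theory and Fine Properties of Functions*, revised ed., CRC Press (2015), §4.2.3 Thm 4.5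
  (Lipschitz = `W^{1,∞}_loc`), §6.2 Thm 6.5 (a.e. derivative = weak derivative), §3.1.2 Thm 3.2 (Rademacher).
  [cite: EvansGariepy2015, Thm 4.5 / Thm 6.5]
-/

noncomputable section

open MeasureTheory Set Function Metric Filter InnerProductSpace
open scoped Topology RealInnerProductSpace NNReal ENNReal Laplacian

namespace Literature.Analysis.FluidPDE

variable {E : Type*} [NormedAddCommGroup E] [InnerProductSpace ℝ E] [FiniteDimensional ℝ E]
  [MeasurableSpace E] [BorelSpace E]

namespace NazarovUraltseva2011

/-! ### Cut-off extensions of functions that are smooth on an open set -/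

omit [FiniteDimensional ℝ E] [MeasurableSpace E] [BorelSpace E] in
/-- A function `C^n` on an open set `U`, multiplied by a `C^n` cut-off whose topological support lies in `U`,
is `C^n` on the whole space. [folklore] -/
private theorem contDiff_smul_of_contDiffOn {F : Type*} [NormedAddCommGroup F] [NormedSpace ℝ F] {n : ℕ∞}
    {θ : E → ℝ} {f : E → F} {U : Set E} (hU : IsOpen U) (hθ : ContDiff ℝ n θ)
    (hθU : tsupport θ ⊆ U) (hf : ContDiffOn ℝ n f U) : ContDiff ℝ n (fun x => θ x • f x) := by
  rw [contDiff_iff_contDiffAt]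
  intro x
  by_cases hx : x ∈ U
  · exact hθ.contDiffAt.smul (hf.contDiffAt (hU.mem_nhds hx))
  · have hx' : x ∉ tsupport θ := fun h => hx (hθU h)
    have h0 : (fun y => θ y • f y) =ᶠ[𝓝 x] fun _ => 0 := by
      filter_upwards [(notMem_tsupport_iff_eventuallyEq.mp hx')] with y hy
      simp [hy]
    exact (contDiffAt_const.congr_of_eventuallyEq h0)

omit [InnerProductSpace ℝ E] [FiniteDimensional ℝ E] [MeasurableSpace E] [BorelSpace E] in
/-- A product `a · g` with `a` continuous on an open set `U` and `g` continuous with topological support in `U`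
is continuous everywhere. [folklore] -/
private theorem continuous_mul_of_continuousOn {a g : E → ℝ} {U : Set E} (hU : IsOpen U)
    (ha : ContinuousOn a U) (hg : Continuous g) (hgU : tsupport g ⊆ U) :
    Continuous fun x => a x * g x := by
  rw [continuous_iff_continuousAt]
  intro x
  by_cases hx : x ∈ U
  · exact (ha.continuousAt (hU.mem_nhds hx)).mul hg.continuousAt
  · have hx' : x ∉ tsupport g := fun h => hx (hgU h)
    have h0 : (fun y => a y * g y) =ᶠ[𝓝 x] fun _ => 0 := by
      filter_upwards [(notMem_tsupport_iff_eventuallyEq.mp hx')] with y hy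
      simp [hy]
    exact (continuousAt_const.congr_of_eventuallyEq h0)

/-! ### Integration by parts against a Lipschitz test function -/

/-- **`∫ ⟪∇W, ∇g⟫ = -∫ (ΔW) g`** for `W ∈ C²_c(E)` and a compactly supported LIPSCHITZ `g` (whose gradient exists
a.e. by Rademacher's theorem; Mathlib's `integral_lineDeriv_mul_eq` is the integration by parts for Lipschitz
pairs, coordinate by coordinate in an orthonormal basis) — the a.e. gradient of a Lipschitz function is its weak gradient
(Evans–Gariepy, Thm 4.5 with Thm 6.5). [cite: EvansGariepy2015, Thm 4.5 / Thm 6.5] -/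
theorem integral_inner_gradient_eq_neg_integral_laplacian_mul {W g : E → ℝ} (hW : ContDiff ℝ 2 W)
    (hWc : HasCompactSupport W) {K : ℝ≥0} (hg : LipschitzWith K g) (hgc : HasCompactSupport g) :
    ∫ x, ⟪gradient W x, gradient g x⟫ = - ∫ x, (Δ W) x * g x := by
  haveI : CompleteSpace E := FiniteDimensional.complete ℝ E
  let e := stdOrthonormalBasis ℝ E
  -- the partial derivatives `ψ i = ∂ᵢ W` are `C¹` with compact support, hence Lipschitz
  set ψ : Fin (Module.finrank ℝ E) → E → ℝ := fun i x => fderiv ℝ W x (e i) with hψ_def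
  have hW1 : ContDiff ℝ 1 (fderiv ℝ W) := hW.fderiv_right (m := 1) le_rfl
  have hψ1 : ∀ i, ContDiff ℝ 1 (ψ i) := fun i => hW1.clm_apply contDiff_const
  have hψc : ∀ i, HasCompactSupport (ψ i) := fun i => hWc.fderiv_apply (𝕜 := ℝ) (e i)
  have hψlip : ∀ i, ∃ C, LipschitzWith C (ψ i) := fun i =>
    (hψ1 i).lipschitzWith_of_hasCompactSupport (hψc i) one_ne_zero
  -- `g` is differentiable a.e. (Rademacher), where its line derivatives are the coordinates of its gradient
  have hg_ae : ∀ᵐ x ∂(volume : Measure E), DifferentiableAt ℝ g x := hg.ae_differentiableAt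
  have hgrad_bd : ∀ x, ‖gradient g x‖ ≤ K := by
    intro x
    by_cases hx : DifferentiableAt ℝ g x
    · have h1 : ‖fderiv ℝ g x‖ ≤ K := norm_fderiv_le_of_lipschitz ℝ hg
      simpa [gradient] using h1
    · simp [gradient_eq_zero_of_not_differentiableAt hx]
  have hgrad_meas : Measurable (gradient g) := by
    have : gradient g = fun x => (InnerProductSpace.toDual ℝ E).symm (fderiv ℝ g x) := rfl
    rw [this]
    exact (InnerProductSpace.toDual ℝ E).symm.continuous.measurable.comp (measurable_fderiv ℝ g)
  -- Step 1: coordinatewise integration by parts `∫ ψᵢ ∂ᵢg = -∫ ∂ᵢψᵢ g`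
  have step : ∀ i, ∫ x, ψ i x * ⟪gradient g x, e i⟫ =
      - ∫ x, fderiv ℝ (ψ i) x (e i) * g x := by
    intro i
    obtain ⟨C, hC⟩ := hψlip i
    have hibp := hC.integral_lineDeriv_mul_eq (μ := volume) hg hgc (e i)
    -- left side of `hibp`: `lineDeriv ψᵢ = fderiv ψᵢ`
    have hl : ∀ x, lineDeriv ℝ (ψ i) x (e i) = fderiv ℝ (ψ i) x (e i) := fun x =>
      ((hψ1 i).differentiable one_ne_zero x).lineDeriv_eq_fderiv
    -- right side: a.e. `lineDeriv g x (-eᵢ) = -⟪∇g x, eᵢ⟫`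
    have hr : (fun x => lineDeriv ℝ g x (-(e i)) * ψ i x) =ᵐ[volume]
        fun x => -(ψ i x * ⟪gradient g x, e i⟫) := by
      filter_upwards [hg_ae] with x hx
      rw [lineDeriv_neg, hx.lineDeriv_eq_fderiv, ← inner_gradient_left]
      ring
    simp_rw [hl] at hibp
    rw [integral_congr_ae hr, integral_neg] at hibp
    linarith
  -- Step 2: sum over the basis
  have hlap : ∀ x, (Δ W) x = ∑ i, fderiv ℝ (ψ i) x (e i) := fun x =>
    laplacian_eq_sum_fderiv_fderiv e hW x
  have hsumL : ∀ x, ⟪gradient W x, gradient g x⟫ = ∑ i, ψ i x * ⟪gradient g x, e i⟫ := by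
    intro x
    rw [← e.sum_inner_mul_inner (gradient W x) (gradient g x)]
    refine Finset.sum_congr rfl fun i _ => ?_
    rw [hψ_def, inner_gradient_left, real_inner_comm]
  have hintL : ∀ i, Integrable (fun x => ψ i x * ⟪gradient g x, e i⟫) (volume : Measure E) := by
    intro i
    have h1 : Integrable (ψ i) (volume : Measure E) :=
      (hψ1 i).continuous.integrable_of_hasCompactSupport (hψc i)
    refine h1.mul_bdd (c := K) (hgrad_meas.inner_const.aestronglyMeasurable) ?_
    refine Eventually.of_forall fun x => ?_
    calc ‖⟪gradient g x, e i⟫‖ ≤ ‖gradient g x‖ * ‖e i‖ := norm_inner_le_norm _ _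
      _ ≤ K * 1 := by
        gcongr
        · exact hgrad_bd x
        · exact (e.orthonormal.1 i).le
      _ = K := mul_one _
  have hintR : ∀ i, Integrable (fun x => fderiv ℝ (ψ i) x (e i) * g x) (volume : Measure E) := by
    intro i
    refine Continuous.integrable_of_hasCompactSupport ?_ ?_
    · exact (((hψ1 i).continuous_fderiv one_ne_zero).clm_apply continuous_const).mul hg.continuous
    · exact hgc.mul_left
  have hL : ∫ x, ⟪gradient W x, gradient g x⟫ = ∑ i, ∫ x, ψ i x * ⟪gradient g x, e i⟫ := by
    rw [← integral_finsetSum _ fun i _ => hintL i]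
    exact integral_congr_ae (Eventually.of_forall hsumL)
  have hR : ∫ x, (Δ W) x * g x = ∑ i, ∫ x, fderiv ℝ (ψ i) x (e i) * g x := by
    rw [← integral_finsetSum _ fun i _ => hintR i]
    refine integral_congr_ae (Eventually.of_forall fun x => ?_)
    simp only [hlap x, Finset.sum_mul]
  rw [hL, hR, ← Finset.sum_neg_distrib]
  exact Finset.sum_congr rfl fun i _ => step i


/-! ### Measurability of gradients; support of slices -/

omit [FiniteDimensional ℝ E] in
/-- The gradient of ANY real function on a finite-dimensional inner product space is measurable (the
differentiability set is Borel; Mathlib `measurable_fderiv`). [folklore] -/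
private theorem measurable_gradient [CompleteSpace E] (g : E → ℝ) : Measurable (gradient g) := by
  have : gradient g = fun x => (InnerProductSpace.toDual ℝ E).symm (fderiv ℝ g x) := rfl
  rw [this]
  exact (InnerProductSpace.toDual ℝ E).symm.continuous.measurable.comp (measurable_fderiv ℝ g)

omit [InnerProductSpace ℝ E] [FiniteDimensional ℝ E] [MeasurableSpace E] [BorelSpace E] in
/-- Off the space–time support of `φ`, the space slice `φ t` vanishes near the point. [folklore] -/
private theorem notMem_tsupport_slice_of_notMem_tsupport_uncurry {F : Type*} [Zero F] [TopologicalSpace F]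
    {φ : ℝ → E → F} {p : ℝ × E} (hp : p ∉ tsupport (uncurry φ)) : p.2 ∉ tsupport (φ p.1) := by
  intro h
  have hsub : tsupport (φ p.1) ⊆ Prod.mk p.1 ⁻¹' tsupport (uncurry φ) := by
    refine closure_minimal (fun y hy => subset_tsupport _ ?_) ?_
    · exact hy
    · exact (isClosed_tsupport _).preimage (Continuous.prodMk_right p.1)
  exact hp (hsub h)

omit [InnerProductSpace ℝ E] [FiniteDimensional ℝ E] [MeasurableSpace E] [BorelSpace E] in
/-- A function continuous on an open set `U` and vanishing off a closed subset `K ⊆ U` is continuous. [folklore] -/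
private theorem continuous_of_continuousOn_of_eq_zero {X : Type*} [TopologicalSpace X] {f : X → ℝ} {U K : Set X}
    (hU : IsOpen U) (hf : ContinuousOn f U) (hK : IsClosed K) (hKU : K ⊆ U) (h0 : ∀ x ∉ K, f x = 0) :
    Continuous f := by
  rw [continuous_iff_continuousAt]
  intro x
  by_cases hx : x ∈ U
  · exact hf.continuousAt (hU.mem_nhds hx)
  · have hxK : x ∉ K := fun h => hx (hKU h)
    have hev : f =ᶠ[𝓝 x] fun _ => 0 := by
      filter_upwards [hK.isOpen_compl.mem_nhds hxK] with y hy
      exact h0 y hy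
    exact continuousAt_const.congr_of_eventuallyEq hev

/-! ### The drift: a `C¹` divergence-free field on the cylinder is divergence free in `𝒟′` -/

/-- For a drift `b` that is `C¹` on the open cylinder `(0,T) × B(0,1)` with `div b(t,·) = 0` there, and every smooth `φ`
compactly supported inside the cylinder, `∫∫ ⟪b, ∇ₓφ⟫ = 0` (Fubini in time, then the whole-space identity
`∫ φ div u + ∫ ⟪u, ∇φ⟫ = 0` of `WholeSpaceIBP` applied to a cut-off extension `u` of `b(t,·)`): a classical divergence-free
drift is divergence free in the sense of distributions required by Nazarov–Ural'tseva's standing assumptions.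
[cite: NazarovUraltseva2011HarnackDivFree, §1 (arXiv p.2) standing assumptions on b] -/
theorem setIntegral_inner_drift_gradient_eq_zero {T : ℝ} {b : ℝ → E → E}
    (hb1 : ContDiffOn ℝ 1 (uncurry b) (Ioo 0 T ×ˢ ball (0 : E) 1))
    (hbdiv : ∀ t ∈ Ioo 0 T, ∀ x ∈ ball (0 : E) 1, VectorCalculus.divergence (b t) x = 0)
    {φ : ℝ → E → ℝ} (hφ : ContDiff ℝ (⊤ : ℕ∞) (uncurry φ)) (hφc : HasCompactSupport (uncurry φ))
    (hφS : tsupport (uncurry φ) ⊆ Ioo 0 T ×ˢ ball (0 : E) 1) :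
    ∫ p in Ioo 0 T ×ˢ ball (0 : E) 1, ⟪b p.1 p.2, gradient (φ p.1) p.2⟫ = 0 := by
  haveI : CompleteSpace E := FiniteDimensional.complete ℝ E
  set S : Set (ℝ × E) := Ioo 0 T ×ˢ ball (0 : E) 1 with hS_def
  have hS : IsOpen S := isOpen_Ioo.prod isOpen_ball
  set K : Set (ℝ × E) := tsupport (uncurry φ) with hK_def
  have hK : IsCompact K := hφc
  -- the integrand, its vanishing off `K`, and a closed form
  set G : ℝ × E → ℝ := fun p => ⟪b p.1 p.2, gradient (φ p.1) p.2⟫ with hG_def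
  have hgrad0 : ∀ p ∉ K, gradient (φ p.1) p.2 = 0 := fun p hp =>
    gradient_eq_zero_of_notMem_tsupport (notMem_tsupport_slice_of_notMem_tsupport_uncurry hp)
  have hG0 : ∀ p ∉ K, G p = 0 := fun p hp => by
    simp only [hG_def]
    rw [hgrad0 p hp, inner_zero_right]
  have hφ1 : ContDiff ℝ 1 (uncurry φ) := hφ.of_le (by exact_mod_cast le_top)
  have hGeq : ∀ p, G p = fderiv ℝ (uncurry φ) p ((0 : ℝ), b p.1 p.2) := by
    rintro ⟨s, y⟩
    have h1 : HasFDerivAt (uncurry φ) (fderiv ℝ (uncurry φ) (s, y)) (s, y) :=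
      ((hφ1.differentiable one_ne_zero) _).hasFDerivAt
    have h2 : HasFDerivAt (φ s) ((fderiv ℝ (uncurry φ) (s, y)).comp
        (ContinuousLinearMap.inr ℝ ℝ E)) y := h1.comp y (hasFDerivAt_prodMk_right s y)
    simp only [hG_def]
    rw [real_inner_comm, inner_gradient_left, h2.fderiv, ContinuousLinearMap.comp_apply,
      ContinuousLinearMap.inr_apply]
  have hGcontS : ContinuousOn G S := by
    have hc1 : Continuous (fderiv ℝ (uncurry φ)) := hφ1.continuous_fderiv one_ne_zero
    have hc2 : ContinuousOn (fun p : ℝ × E => ((0 : ℝ), b p.1 p.2)) S :=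
      continuousOn_const.prodMk hb1.continuousOn
    have : G = fun p => fderiv ℝ (uncurry φ) p ((0 : ℝ), b p.1 p.2) := funext hGeq
    rw [this]
    exact hc1.continuousOn.clm_apply hc2
  have hGcont : Continuous G :=
    continuous_of_continuousOn_of_eq_zero hS hGcontS (isClosed_tsupport _) hφS hG0
  have hGc : HasCompactSupport G := HasCompactSupport.intro hK hG0
  have hGint : Integrable G (volume : Measure (ℝ × E)) := hGcont.integrable_of_hasCompactSupport hGc
  -- Fubini
  rw [Measure.volume_eq_prod, setIntegral_prod G hGint.integrableOn]
  refine (setIntegral_congr_fun measurableSet_Ioo (g := fun _ => (0 : ℝ)) fun t ht => ?_).trans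
    (by simp)
  -- the slice at time `t ∈ (0, T)`
  show ∫ x in ball (0 : E) 1, G (t, x) = 0
  have hKx : IsCompact (Prod.snd '' K) := hK.image continuous_snd
  have hKx1 : Prod.snd '' K ⊆ ball (0 : E) 1 := by
    rintro _ ⟨q, hq, rfl⟩
    exact (hφS hq).2
  obtain ⟨ρ, hρ1, hKρ⟩ := exists_lt_subset_ball hKx.isClosed hKx1
  set ρ₀ : ℝ := max ρ 0 with hρ₀_def
  have hρ₀1 : ρ₀ < 1 := max_lt hρ1 one_pos
  have hρ₀0 : 0 ≤ ρ₀ := le_max_right _ _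
  have hKρ₀ : Prod.snd '' K ⊆ ball (0 : E) ρ₀ := hKρ.trans (ball_subset_ball (le_max_left _ _))
  let θ : ContDiffBump (0 : E) := ⟨(2 * ρ₀ + 1) / 3, (ρ₀ + 2) / 3, by linarith, by linarith⟩
  have hθ1 : ∀ x ∈ ball (0 : E) ρ₀, θ =ᶠ[𝓝 x] 1 := fun x hx =>
    θ.eventuallyEq_one_of_mem_ball (ball_subset_ball (by show ρ₀ ≤ (2 * ρ₀ + 1) / 3; linarith) hx)
  have hθsupp : tsupport (θ : E → ℝ) ⊆ ball (0 : E) 1 := by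
    rw [θ.tsupport_eq]
    exact closedBall_subset_ball (by show (ρ₀ + 2) / 3 < 1; linarith)
  -- the slice `b t` and its cut-off extension `u`
  have hbt1 : ContDiffOn ℝ 1 (b t) (ball (0 : E) 1) :=
    hb1.comp (contDiff_prodMk_right t).contDiffOn fun x hx => mk_mem_prod ht hx
  set u : E → E := fun x => θ x • b t x with hu_def
  have hu1 : ContDiff ℝ 1 u := contDiff_smul_of_contDiffOn isOpen_ball θ.contDiff hθsupp hbt1
  have hub : ∀ x ∈ ball (0 : E) ρ₀, u =ᶠ[𝓝 x] b t := fun x hx => by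
    filter_upwards [hθ1 x hx] with y hy
    simp [hu_def, hy]
  -- the slice `φ t`
  have hφt1 : ContDiff ℝ 1 (φ t) := hφ1.comp (contDiff_prodMk_right t)
  have hφt0 : ∀ x ∉ Prod.snd '' K, φ t x = 0 := fun x hx => by
    have : (t, x) ∉ K := fun h => hx ⟨(t, x), h, rfl⟩
    exact image_eq_zero_of_notMem_tsupport (f := uncurry φ) this
  have hφtc : HasCompactSupport (φ t) := HasCompactSupport.intro hKx hφt0
  -- whole-space identity
  have hibp := integral_mul_divergence_add_eq_zero_left hφt1 hu1 hφtc
  have hdiv0 : ∫ x, φ t x * VectorCalculus.divergence u x = 0 := by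
    refine integral_eq_zero_of_ae (Eventually.of_forall fun x => ?_)
    by_cases hx : φ t x = 0
    · simp [hx]
    · have hxK : x ∈ Prod.snd '' K := by
        by_contra h
        exact hx (hφt0 x h)
      have hx1 : x ∈ ball (0 : E) 1 := hKx1 hxK
      have hdu : VectorCalculus.divergence u x = VectorCalculus.divergence (b t) x := by
        unfold VectorCalculus.divergence
        rw [(hub x (hKρ₀ hxK)).fderiv_eq]
      simp [hdu, hbdiv t ht x hx1]
  rw [hdiv0, zero_add] at hibp
  -- back to the ball
  have hzero : ∀ x ∉ ball (0 : E) 1, G (t, x) = 0 := fun x hx =>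
    hG0 _ fun h => hx (hφS h).2
  rw [setIntegral_eq_integral_of_forall_compl_eq_zero hzero, ← hibp]
  refine integral_congr_ae (Eventually.of_forall fun x => ?_)
  simp only [hG_def]
  by_cases hxK : (t, x) ∈ K
  · have hx0 : x ∈ ball (0 : E) ρ₀ := hKρ₀ ⟨(t, x), hxK, rfl⟩
    rw [(hub x hx0).self_of_nhds]
  · rw [hgrad0 _ hxK]
    simp

/-! ### The slices of a classical supersolution satisfy the weak inequality -/

omit [FiniteDimensional ℝ E] [MeasurableSpace E] [BorelSpace E] in
/-- Time derivative along a line as the space–time Fréchet derivative. [folklore] -/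
private theorem deriv_timeLine_eq_fderiv_uncurry {V : ℝ → E → ℝ} {U : Set (ℝ × E)} (hU : IsOpen U)
    (hV : ContDiffOn ℝ 1 (uncurry V) U) {t : ℝ} {x : E} (htx : (t, x) ∈ U) :
    deriv (fun s => V s x) t = fderiv ℝ (uncurry V) (t, x) ((1 : ℝ), (0 : E)) := by
  have h1 : HasFDerivAt (uncurry V) (fderiv ℝ (uncurry V) (t, x)) (t, x) :=
    ((hV.differentiableOn one_ne_zero).differentiableAt (hU.mem_nhds htx)).hasFDerivAt
  have h2 : HasDerivAt (fun s => V s x)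
      (((fderiv ℝ (uncurry V) (t, x)).comp (ContinuousLinearMap.inl ℝ ℝ E)) 1) t := by
    have h := (h1.comp t (hasFDerivAt_prodMk_left t x)).hasDerivAt
    exact h
  rw [h2.deriv, ContinuousLinearMap.comp_apply, ContinuousLinearMap.inl_apply]

/-- **Slice inequality.** For `V` of class `C²` on the open cylinder `(0,T) × B(0,1)`, a continuous drift `b` there,
and the pointwise inequality `∂ₜV − ΔV + b·∇V ≥ 0`, every slice `t ∈ (0,T)` satisfies
`∫_{B(0,1)} (∂ₜV η + ⟪∇V, ∇η⟫ + ⟪b', ∇V⟫ η)(t,·) ≥ 0` for every nonnegative test function `η` Lipschitz in space–time and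
vanishing for `‖x‖ ≥ ρ` (`ρ < 1`), and every `b'` agreeing with `b` on the cylinder (integration by parts in `x` only,
against the Lipschitz test function): a classical supersolution is a generalized supersolution in the printed sense.
[cite: NazarovUraltseva2011HarnackDivFree, §3 (arXiv p.8) generalized supersolutions, Lipschitz test functions] -/
theorem setIntegral_slice_supersolution_nonneg {T : ℝ} {V : ℝ → E → ℝ} {b b' : ℝ → E → E}
    (hV2 : ContDiffOn ℝ 2 (uncurry V) (Ioo 0 T ×ˢ ball (0 : E) 1))
    (hb : ContinuousOn (uncurry b) (Ioo 0 T ×ˢ ball (0 : E) 1))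
    (hbb' : ∀ t ∈ Ioo 0 T, ∀ x ∈ ball (0 : E) 1, b' t x = b t x)
    (hsuper : ∀ t ∈ Ioo 0 T, ∀ x ∈ ball (0 : E) 1,
      0 ≤ deriv (fun τ => V τ x) t - (Δ (V t)) x + ⟪b t x, gradient (V t) x⟫)
    {η : ℝ → E → ℝ} {K : ℝ≥0} (hη : LipschitzWith K (uncurry η)) (hη0 : ∀ t x, 0 ≤ η t x)
    {ρ : ℝ} (hρ1 : ρ < 1) (hηρ : ∀ t x, ρ ≤ ‖x‖ → η t x = 0) {t : ℝ} (ht : t ∈ Ioo 0 T) :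
    0 ≤ ∫ x in ball (0 : E) 1,
      (deriv (fun s => V s x) t * η t x + ⟪gradient (V t) x, gradient (η t) x⟫ +
        ⟪b' t x, gradient (V t) x⟫ * η t x) := by
  haveI : CompleteSpace E := FiniteDimensional.complete ℝ E
  set S : Set (ℝ × E) := Ioo 0 T ×ˢ ball (0 : E) 1 with hS_def
  have hS : IsOpen S := isOpen_Ioo.prod isOpen_ball
  -- radii `ρ₀ < rIn < rOut < 1`
  set ρ₀ : ℝ := max ρ 0 with hρ₀_def
  have hρ₀1 : ρ₀ < 1 := max_lt hρ1 one_pos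
  have hρ₀0 : 0 ≤ ρ₀ := le_max_right _ _
  have hη0' : ∀ x, ρ₀ ≤ ‖x‖ → η t x = 0 := fun x hx => hηρ t x ((le_max_left _ _).trans hx)
  let θ : ContDiffBump (0 : E) := ⟨(2 * ρ₀ + 1) / 3, (ρ₀ + 2) / 3, by linarith, by linarith⟩
  have hrIn : ρ₀ < (2 * ρ₀ + 1) / 3 := by linarith
  have hrIn1 : (2 * ρ₀ + 1) / 3 < 1 := by linarith
  have hθsupp : tsupport (θ : E → ℝ) ⊆ ball (0 : E) 1 := by
    rw [θ.tsupport_eq]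
    exact closedBall_subset_ball (by show (ρ₀ + 2) / 3 < 1; linarith)
  -- the slice `V t` and its cut-off extension `W`
  have hVt2 : ContDiffOn ℝ 2 (V t) (ball (0 : E) 1) :=
    hV2.comp (contDiff_prodMk_right t).contDiffOn fun x hx => mk_mem_prod ht hx
  set W : E → ℝ := fun x => θ x • V t x with hW_def
  have hW2 : ContDiff ℝ 2 W := contDiff_smul_of_contDiffOn isOpen_ball θ.contDiff hθsupp hVt2
  have hWc : HasCompactSupport W := θ.hasCompactSupport.smul_right
  have hWV : ∀ x ∈ ball (0 : E) ((2 * ρ₀ + 1) / 3), W =ᶠ[𝓝 x] V t := fun x hx => by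
    filter_upwards [θ.eventuallyEq_one_of_mem_ball hx] with y hy
    simp [hW_def, hy]
  -- the slice `η t`: Lipschitz, compactly supported in `closedBall 0 ρ₀`
  have hg : LipschitzWith (K * 1) (η t) := hη.comp (LipschitzWith.prodMk_left t)
  have hg0 : ∀ x ∉ closedBall (0 : E) ρ₀, η t x = 0 := fun x hx => by
    refine hη0' x (le_of_lt ?_)
    simpa [mem_closedBall, dist_zero_right] using hx
  have hgc : HasCompactSupport (η t) := HasCompactSupport.intro (isCompact_closedBall _ _) hg0
  have hgsupp : tsupport (η t) ⊆ closedBall (0 : E) ρ₀ :=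
    closure_minimal (fun x hx => by by_contra h; exact hx (hg0 x h)) isClosed_closedBall
  have hgsupp1 : tsupport (η t) ⊆ ball (0 : E) 1 := hgsupp.trans (closedBall_subset_ball hρ₀1)
  have hgrad0 : ∀ x, ρ₀ < ‖x‖ → gradient (η t) x = 0 := fun x hx =>
    gradient_eq_zero_of_notMem_tsupport fun h => by
      have := hgsupp h
      rw [mem_closedBall, dist_zero_right] at this
      linarith
  -- the four integrands on the whole space
  set A : E → ℝ := fun x => deriv (fun s => V s x) t * η t x with hA_def
  set Bm : E → ℝ := fun x => ⟪gradient W x, gradient (η t) x⟫ with hBm_def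
  set C : E → ℝ := fun x => ⟪b t x, gradient W x⟫ * η t x with hC_def
  set D : E → ℝ := fun x => (Δ W) x * η t x with hD_def
  -- (1) the integrand equals `A + Bm + C` on the whole space, and vanishes off the ball
  have hF_eq : ∀ x, deriv (fun s => V s x) t * η t x + ⟪gradient (V t) x, gradient (η t) x⟫ +
      ⟪b' t x, gradient (V t) x⟫ * η t x = A x + Bm x + C x := by
    intro x
    by_cases hx : ‖x‖ < (2 * ρ₀ + 1) / 3
    · have hx1 : x ∈ ball (0 : E) 1 := by
        rw [mem_ball, dist_zero_right]; linarith
      have hxr : x ∈ ball (0 : E) ((2 * ρ₀ + 1) / 3) := by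
        rw [mem_ball, dist_zero_right]; exact hx
      rw [hA_def, hBm_def, hC_def]
      simp only [(hWV x hxr).gradient_eq, hbb' t ht x hx1]
    · have hx' : ρ₀ < ‖x‖ := by linarith
      rw [hA_def, hBm_def, hC_def]
      simp only [hη0' x hx'.le, hgrad0 x hx', mul_zero, inner_zero_right, add_zero]
  have hF_zero : ∀ x ∉ ball (0 : E) 1, deriv (fun s => V s x) t * η t x +
      ⟪gradient (V t) x, gradient (η t) x⟫ + ⟪b' t x, gradient (V t) x⟫ * η t x = 0 := by
    intro x hx
    have hx' : ρ₀ < ‖x‖ := by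
      rw [mem_ball, dist_zero_right, not_lt] at hx; linarith
    rw [hη0' x hx'.le, hgrad0 x hx', mul_zero, inner_zero_right, mul_zero, add_zero, add_zero]
  -- (2) the pointwise sign of `A - D + C`
  have hsign : ∀ x, 0 ≤ A x - D x + C x := by
    intro x
    by_cases hgx : η t x = 0
    · rw [hA_def, hC_def, hD_def]
      simp only [hgx, mul_zero, sub_zero, add_zero, le_refl]
    · have hx0 : ‖x‖ < ρ₀ := by
        by_contra h
        exact hgx (hη0' x (not_lt.mp h))
      have hx1 : x ∈ ball (0 : E) 1 := by
        rw [mem_ball, dist_zero_right]; linarith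
      have hxr : x ∈ ball (0 : E) ((2 * ρ₀ + 1) / 3) := by
        rw [mem_ball, dist_zero_right]; linarith
      have hlap : (Δ W) x = (Δ (V t)) x := (laplacian_congr_nhds (hWV x hxr)).self_of_nhds
      have hgr : gradient W x = gradient (V t) x := (hWV x hxr).gradient_eq
      have : A x - D x + C x =
          (deriv (fun τ => V τ x) t - (Δ (V t)) x + ⟪b t x, gradient (V t) x⟫) * η t x := by
        rw [hA_def, hC_def, hD_def]
        simp only [hlap, hgr]; ring
      rw [this]
      exact mul_nonneg (hsuper t ht x hx1) (hη0 t x)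
  -- (3) integrability of `A`, `Bm`, `C`, `D`
  have hderiv_eq : ∀ x ∈ ball (0 : E) 1,
      deriv (fun s => V s x) t = fderiv ℝ (uncurry V) (t, x) ((1 : ℝ), (0 : E)) := fun x hx =>
    deriv_timeLine_eq_fderiv_uncurry hS (hV2.of_le (by norm_num)) (mk_mem_prod ht hx)
  have ha_cont : ContinuousOn (fun x => deriv (fun s => V s x) t) (ball (0 : E) 1) := by
    have h1 : ContinuousOn (fun x => fderiv ℝ (uncurry V) (t, x) ((1 : ℝ), (0 : E))) (ball (0 : E) 1) :=
      ((hV2.continuousOn_fderiv_of_isOpen hS (by norm_num)).comp (Continuous.prodMk_right t).continuousOn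
        (fun x hx => mk_mem_prod ht hx)).clm_apply continuousOn_const
    exact h1.congr fun x hx => hderiv_eq x hx
  have hintA : Integrable A (volume : Measure E) :=
    (continuous_mul_of_continuousOn isOpen_ball ha_cont hg.continuous hgsupp1).integrable_of_hasCompactSupport
      hgc.mul_left
  have hgradW : Continuous (gradient W) := continuous_gradient_of_contDiff (hW2.of_le (by norm_num))
  have hgrad_bd : ∀ x, ‖gradient (η t) x‖ ≤ K * 1 := by
    intro x
    by_cases hx : DifferentiableAt ℝ (η t) x
    · have h1 : ‖fderiv ℝ (η t) x‖ ≤ K * 1 := norm_fderiv_le_of_lipschitz ℝ hg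
      simpa [gradient] using h1
    · simp [gradient_eq_zero_of_not_differentiableAt hx]
  have hintBm : Integrable Bm (volume : Measure E) := by
    refine Integrable.mono' (g := fun x => ‖gradient W x‖ * (K * 1)) ?_ ?_ ?_
    · have hgradWc : HasCompactSupport (gradient W) :=
        (hWc.fderiv (𝕜 := ℝ)).comp_left (g := (InnerProductSpace.toDual ℝ E).symm) (map_zero _)
      exact (hgradW.norm.mul continuous_const).integrable_of_hasCompactSupport hgradWc.norm.mul_right
    · exact (hgradW.measurable.inner (measurable_gradient (η t))).aestronglyMeasurable
    · refine Eventually.of_forall fun x => ?_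
      calc ‖Bm x‖ ≤ ‖gradient W x‖ * ‖gradient (η t) x‖ := norm_inner_le_norm _ _
        _ ≤ ‖gradient W x‖ * (K * 1) := by gcongr; exact hgrad_bd x
  have hbt : ContinuousOn (b t) (ball (0 : E) 1) :=
    hb.comp (Continuous.prodMk_right t).continuousOn fun x hx => mk_mem_prod ht hx
  have hintC : Integrable C (volume : Measure E) :=
    (continuous_mul_of_continuousOn isOpen_ball (hbt.inner hgradW.continuousOn) hg.continuous
      hgsupp1).integrable_of_hasCompactSupport hgc.mul_left
  have hintD : Integrable D (volume : Measure E) :=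
    ((continuous_laplacian hW2).mul hg.continuous).integrable_of_hasCompactSupport hgc.mul_left
  -- (4) assemble
  have hIBP : ∫ x, Bm x = -∫ x, D x :=
    integral_inner_gradient_eq_neg_integral_laplacian_mul hW2 hWc hg hgc
  rw [setIntegral_eq_integral_of_forall_compl_eq_zero hF_zero]
  rw [integral_congr_ae (Eventually.of_forall hF_eq : _ =ᵐ[volume] fun x => A x + Bm x + C x)]
  have e1 := integral_add (hintA.add hintBm) hintC
  have e2 := integral_add hintA hintBm
  have e3 := integral_sub hintA hintD
  have e4 := integral_add (hintA.sub hintD) hintC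
  simp only [Pi.add_apply, Pi.sub_apply] at e1 e2 e3 e4
  have hpos := integral_nonneg (μ := (volume : Measure E)) (f := fun x => A x - D x + C x) fun x => hsign x
  rw [e4, e3] at hpos
  rw [e1, e2, hIBP]
  linarith


/-- **Space–time inequality.** Under the hypotheses of `setIntegral_slice_supersolution_nonneg`, the generalized-supersolution
inequality `∫∫_{(0,T)×B(0,1)} (∂ₜV η + ⟪∇V, ∇η⟫ + ⟪b', ∇V⟫ η) ≥ 0` holds (Fubini over the slices; when the integrand is not
integrable the Bochner integral vanishes and the inequality is trivial): a classical supersolution is a generalized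
supersolution in the printed sense. [cite: NazarovUraltseva2011HarnackDivFree, §3 (arXiv p.8) generalized supersolutions] -/
theorem setIntegral_cylinder_supersolution_nonneg {T : ℝ} {V : ℝ → E → ℝ} {b b' : ℝ → E → E}
    (hV2 : ContDiffOn ℝ 2 (uncurry V) (Ioo 0 T ×ˢ ball (0 : E) 1))
    (hb : ContinuousOn (uncurry b) (Ioo 0 T ×ˢ ball (0 : E) 1))
    (hbb' : ∀ t ∈ Ioo 0 T, ∀ x ∈ ball (0 : E) 1, b' t x = b t x)
    (hsuper : ∀ t ∈ Ioo 0 T, ∀ x ∈ ball (0 : E) 1,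
      0 ≤ deriv (fun τ => V τ x) t - (Δ (V t)) x + ⟪b t x, gradient (V t) x⟫)
    {η : ℝ → E → ℝ} {K : ℝ≥0} (hη : LipschitzWith K (uncurry η)) (hη0 : ∀ t x, 0 ≤ η t x)
    {ρ : ℝ} (hρ1 : ρ < 1) (hηρ : ∀ t x, ρ ≤ ‖x‖ → η t x = 0) :
    0 ≤ ∫ p in Ioo 0 T ×ˢ ball (0 : E) 1,
      (deriv (fun s => V s p.2) p.1 * η p.1 p.2 + ⟪gradient (V p.1) p.2, gradient (η p.1) p.2⟫ +
        ⟪b' p.1 p.2, gradient (V p.1) p.2⟫ * η p.1 p.2) := by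
  set F : ℝ × E → ℝ := fun p =>
    deriv (fun s => V s p.2) p.1 * η p.1 p.2 + ⟪gradient (V p.1) p.2, gradient (η p.1) p.2⟫ +
      ⟪b' p.1 p.2, gradient (V p.1) p.2⟫ * η p.1 p.2 with hF_def
  by_cases hint : IntegrableOn F (Ioo 0 T ×ˢ ball (0 : E) 1) (volume : Measure (ℝ × E))
  · rw [Measure.volume_eq_prod] at hint ⊢
    rw [setIntegral_prod F hint]
    refine setIntegral_nonneg measurableSet_Ioo fun t ht => ?_
    exact setIntegral_slice_supersolution_nonneg hV2 hb hbb' hsuper hη hη0 hρ1 hηρ ht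
  · rw [integral_undef hint]

omit [InnerProductSpace ℝ E] [FiniteDimensional ℝ E] in
/-- The zero extension of a drift continuous on the open cylinder is jointly measurable. [folklore] -/
private theorem measurable_uncurry_indicator_drift {T : ℝ} {b : ℝ → E → E}
    (hb : ContinuousOn (uncurry b) (Ioo 0 T ×ˢ ball (0 : E) 1)) :
    Measurable (uncurry fun t x => (Ioo 0 T ×ˢ ball (0 : E) 1).indicator (uncurry b) (t, x)) := by
  classical
  have h1 : (uncurry fun t x => (Ioo 0 T ×ˢ ball (0 : E) 1).indicator (uncurry b) (t, x)) =
      (Ioo 0 T ×ˢ ball (0 : E) 1).piecewise (uncurry b) 0 := by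
    funext p
    rw [Set.piecewise_eq_indicator]
    rfl
  rw [h1]
  exact hb.measurable_piecewise continuous_zero.continuousOn (measurableSet_Ioo.prod measurableSet_ball)

end NazarovUraltseva2011

open NazarovUraltseva2011 in
/-- **Propagation of positivity, CLASSICAL special case (Lipschitz form).** From the named fact
`NazarovUraltseva2011_positivity_propagation E` (Nazarov–Ural'tseva 2011, Cor. 3.2 / Lei–Ren–Tian 2025, Lemma 2.5, for
Lipschitz generalized supersolutions with a bounded measurable drift that is divergence free in `𝒟′`): for `2 ≤ dim E` and
`δ, T > 0`, `0 < r < 1`, `Λ ≥ 0` there is `β = β(δ,T,r,Λ) > 0` such that every `V` which is `C²` AND Lipschitz on the open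
cylinder `(0,T) × B(0,1)`, nonnegative there, and a POINTWISE supersolution `∂ₜV − ΔV + b·∇V ≥ 0` for a drift `b` that is
`C¹` on the cylinder with `‖b‖ ≤ Λ` and `div b = 0` pointwise, with `|{x ∈ B(0,1) : V(t̄,x) ≥ λ}| ≥ δ` for some
`t̄ ∈ (0,T/3)`, `λ > 0`, satisfies `V ≥ βλ` on `(T/2,T) × B(0,r)`.  (The Lipschitz hypothesis is the one the printed notion of
generalized supersolution carries, NU 2011 p. 2–3 / p. 8; `C²` on the open cylinder alone does not give it.)  Proof: zero-extend
`b` off the cylinder (measurable, bounded, divergence free in `𝒟′` by `setIntegral_inner_drift_gradient_eq_zero`), and verify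
the generalized-supersolution inequality against LIPSCHITZ test functions by integration by parts in `x` only
(`setIntegral_cylinder_supersolution_nonneg`; the printed inequality keeps `∂ₜV·η`, so no integration by parts in `t`).
[cite: NazarovUraltseva2011HarnackDivFree, Cor 3.2 (arXiv p.10)] [cite: LeiRenTian2025, Lemma 2.5 (arXiv p.7)] -/
theorem NazarovUraltseva2011_positivity_propagation.classical_of_lipschitz
    (h : NazarovUraltseva2011_positivity_propagation E) (hE : 2 ≤ Module.finrank ℝ E) :
    ∀ δ T r Λ : ℝ, 0 < δ → 0 < T → 0 < r → r < 1 → 0 ≤ Λ → ∃ β : ℝ, 0 < β ∧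
      ∀ (V : ℝ → E → ℝ) (b : ℝ → E → E),
        ContDiffOn ℝ 2 (Function.uncurry V) (Set.Ioo 0 T ×ˢ Metric.ball (0 : E) 1) →
        (∃ L, LipschitzOnWith L (Function.uncurry V) (Set.Ioo 0 T ×ˢ Metric.ball (0 : E) 1)) →
        ContDiffOn ℝ 1 (Function.uncurry b) (Set.Ioo 0 T ×ˢ Metric.ball (0 : E) 1) →
        (∀ t ∈ Set.Ioo 0 T, ∀ x ∈ Metric.ball (0 : E) 1, ‖b t x‖ ≤ Λ) →
        (∀ t ∈ Set.Ioo 0 T, ∀ x ∈ Metric.ball (0 : E) 1, VectorCalculus.divergence (b t) x = 0) →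
        (∀ t ∈ Set.Ioo 0 T, ∀ x ∈ Metric.ball (0 : E) 1, 0 ≤ V t x) →
        (∀ t ∈ Set.Ioo 0 T, ∀ x ∈ Metric.ball (0 : E) 1,
            0 ≤ deriv (fun τ => V τ x) t - (Δ (V t)) x + ⟪b t x, gradient (V t) x⟫_ℝ) →
        ∀ tbar lam : ℝ, 0 < tbar → tbar < T / 3 → 0 < lam →
          ENNReal.ofReal δ ≤ volume {x : E | x ∈ Metric.ball (0 : E) 1 ∧ lam ≤ V tbar x} →
          ∀ t ∈ Set.Ioo (T / 2) T, ∀ x ∈ Metric.ball (0 : E) r, β * lam ≤ V t x := by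
  intro δ T r Λ hδ hT hr hr1 hΛ
  obtain ⟨β, hβ, hmain⟩ := h hE hΛ hδ hT hr hr1
  refine ⟨β, hβ, ?_⟩
  intro V b hV2 hVlip hb1 hbΛ hbdiv hV0 hsuper tbar lam htbar htbar3 hlam hmeas t ht x hx
  -- the zero extension of the drift
  set bext : ℝ → E → E := fun s y => (Ioo 0 T ×ˢ ball (0 : E) 1).indicator (uncurry b) (s, y)
    with hbext_def
  have hbext_eq : ∀ s ∈ Ioo 0 T, ∀ y ∈ ball (0 : E) 1, bext s y = b s y := fun s hs y hy => by
    simp only [hbext_def]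
    rw [indicator_of_mem (mk_mem_prod hs hy)]
    rfl
  refine hmain (b := bext) ?_ ?_ ?_ hVlip hV0 ?_ hlam ⟨htbar, htbar3⟩ hmeas ht hx
  · -- measurable
    exact measurable_uncurry_indicator_drift hb1.continuousOn
  · -- bounded on the cylinder
    intro s hs y hy
    rw [hbext_eq s hs y hy]
    exact hbΛ s hs y hy
  · -- divergence free in `𝒟′`
    intro φ hφ hφc hφS
    rw [setIntegral_congr_fun (measurableSet_Ioo.prod measurableSet_ball)
      (g := fun p : ℝ × E => ⟪b p.1 p.2, gradient (φ p.1) p.2⟫)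
      (fun p hp => by simp only [hbext_eq p.1 hp.1 p.2 hp.2])]
    exact setIntegral_inner_drift_gradient_eq_zero hb1 hbdiv hφ hφc hφS
  · -- generalized supersolution against Lipschitz test functions
    rintro η ⟨K, hη⟩ hη0 ⟨ρ, τ, hρ1, -, hηρτ⟩
    exact setIntegral_cylinder_supersolution_nonneg hV2 hb1.continuousOn hbext_eq hsuper hη hη0 hρ1
      (fun s y hy => hηρτ s y (Or.inl hy))

open NazarovUraltseva2011 in
/-- **Propagation of positivity, CLASSICAL special case (closed-cylinder form).** As
`NazarovUraltseva2011_positivity_propagation.classical_of_lipschitz`, with the pair "`C²` + Lipschitz on the open cylinder"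
replaced by "`C²` on an open neighbourhood of the CLOSED cylinder `[0,T] × B̄(0,1)`" (a `C¹` function on a neighbourhood of a
compact convex set is Lipschitz on it). [cite: NazarovUraltseva2011HarnackDivFree, Cor 3.2 (arXiv p.10)]
[cite: LeiRenTian2025, Lemma 2.5 (arXiv p.7)] -/
theorem NazarovUraltseva2011_positivity_propagation.classical
    (h : NazarovUraltseva2011_positivity_propagation E) (hE : 2 ≤ Module.finrank ℝ E) :
    ∀ δ T r Λ : ℝ, 0 < δ → 0 < T → 0 < r → r < 1 → 0 ≤ Λ → ∃ β : ℝ, 0 < β ∧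
      ∀ (V : ℝ → E → ℝ) (b : ℝ → E → E),
        (∃ U : Set (ℝ × E), IsOpen U ∧ Set.Icc 0 T ×ˢ Metric.closedBall (0 : E) 1 ⊆ U ∧
          ContDiffOn ℝ 2 (Function.uncurry V) U) →
        ContDiffOn ℝ 1 (Function.uncurry b) (Set.Ioo 0 T ×ˢ Metric.ball (0 : E) 1) →
        (∀ t ∈ Set.Ioo 0 T, ∀ x ∈ Metric.ball (0 : E) 1, ‖b t x‖ ≤ Λ) →
        (∀ t ∈ Set.Ioo 0 T, ∀ x ∈ Metric.ball (0 : E) 1, VectorCalculus.divergence (b t) x = 0) →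
        (∀ t ∈ Set.Ioo 0 T, ∀ x ∈ Metric.ball (0 : E) 1, 0 ≤ V t x) →
        (∀ t ∈ Set.Ioo 0 T, ∀ x ∈ Metric.ball (0 : E) 1,
            0 ≤ deriv (fun τ => V τ x) t - (Δ (V t)) x + ⟪b t x, gradient (V t) x⟫_ℝ) →
        ∀ tbar lam : ℝ, 0 < tbar → tbar < T / 3 → 0 < lam →
          ENNReal.ofReal δ ≤ volume {x : E | x ∈ Metric.ball (0 : E) 1 ∧ lam ≤ V tbar x} →
          ∀ t ∈ Set.Ioo (T / 2) T, ∀ x ∈ Metric.ball (0 : E) r, β * lam ≤ V t x := by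
  intro δ T r Λ hδ hT hr hr1 hΛ
  obtain ⟨β, hβ, hmain⟩ := h.classical_of_lipschitz hE δ T r Λ hδ hT hr hr1 hΛ
  refine ⟨β, hβ, ?_⟩
  rintro V b ⟨U, hU, hcylU, hVU⟩ hb1 hbΛ hbdiv hV0 hsuper tbar lam htbar htbar3 hlam hmeas t ht x hx
  have hsub : Ioo 0 T ×ˢ ball (0 : E) 1 ⊆ Icc 0 T ×ˢ closedBall (0 : E) 1 :=
    prod_mono Ioo_subset_Icc_self ball_subset_closedBall
  have hV2 : ContDiffOn ℝ 2 (uncurry V) (Ioo 0 T ×ˢ ball (0 : E) 1) := hVU.mono (hsub.trans hcylU)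
  -- Lipschitz on the compact convex closed cylinder
  have hlip : ∃ L, LipschitzOnWith L (uncurry V) (Ioo 0 T ×ˢ ball (0 : E) 1) := by
    have hK : IsCompact (Icc 0 T ×ˢ closedBall (0 : E) 1) :=
      isCompact_Icc.prod (isCompact_closedBall _ _)
    have hconv : Convex ℝ (Icc 0 T ×ˢ closedBall (0 : E) 1) :=
      (convex_Icc 0 T).prod (convex_closedBall _ _)
    have hV1 : ContDiffOn ℝ 1 (uncurry V) (Icc 0 T ×ˢ closedBall (0 : E) 1) :=
      (hVU.of_le (by norm_num)).mono hcylU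
    obtain ⟨L, hL⟩ := hV1.exists_lipschitzOnWith one_ne_zero hconv hK
    exact ⟨L, hL.mono hsub⟩
  exact hmain V b hV2 hlip hb1 hbΛ hbdiv hV0 hsuper tbar lam htbar htbar3 hlam hmeas t ht x hx

end Literature.Analysis.FluidPDE

end
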